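import Literature.Claims.NS.Higgins2026
import Literature.Analysis.FunctionSpaces.TorusFourierModes
import Literature.Analysis.FunctionSpaces.TorusLinearisedNSEnergy
import HarnessLib

/-!
# Solo refutation — C158 `Higgins2026` (R. Higgins, «Angular Relaxation on the Integer Lattice and Global
# Regularity of 3D Navier–Stokes», Zenodo 19601189 (v6 of 19546998), 27 pp.)

D-0090 «where NS proofs break» map, cell `ns-claims`; refuter of record ns-claims-refuter-5 g3 (blind prediction
sealed 29498f288d0bcff9 before the pin pages / TYPED). Skeleton of record: `Literature.Claims.NS.Higgins2026`
(typist-7 g7, p529300, sha16 1376cd9ff2cff825). Text of record = census pin `census/texts/Higgins2026/`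
(PDF sha16 915074499d05567a; PDF page = printed page; line numbers = text layer).

**Token = `Theorem26`** — Thm 2.6 (Global enstrophy bound), display (4) p.7 l.18–25 AS PRINTED: ONE function
`Ω_max(E(0), ν)` bounds the Galerkin enstrophy `Ω^(N)(t)` for every smooth divergence-free datum, every `N` and
every `t ≥ 0`. It is the binder `h26` of the skeleton's composition
`claim_of_steps : Theorem26 → GalerkinPassage → Regularity31 → ClaimedTheorem` (the only non-TRUE-type binder:
`regularity31_holds` is proved in the skeleton, `GalerkinPassage` is classical). **Class: FALSE LEMMA
(countermodel)** — `not_Theorem26`: the FREQUENCY RAY of single Fourier modes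
`a_n(x) = (sin 2πn x₃, cos 2πn x₃, 0)` (circularly polarised shear / Beltrami waves on `𝕋³`) has kinetic energy
`E(a_n) = ½` for every `n ≥ 1` but enstrophy `Ω(a_n) = ½ Σ|k|²|â_k|² = n²/2`; `a_n` is a Galerkin mode of order
`n`, so `P_n a_n = a_n` and the order-`n` Galerkin trajectory from it (tree existence theorem
`Torus.exists_isGalerkinTrajectory_of_isGalerkinMode`, RRS 2016 Thm 4.4) has `Ω^(n)(0) = n²/2 > Ω_max(½, ν)` for
`n` large — display (4) fails at `t = 0`. (Along the ray the energy is fixed while the enstrophy is unbounded: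
no function of `(E(0), ν)` can bound `Ω(0)`; the printed «Phase 1» bound `Ω^(N) ≤ N²E(0)` is attained.)

**Alongside, inside the printed proof of Thm 2.6** (not binders of `claim_of_steps` in skeleton rev 1):
`not_Kol_perShell` — p.7 l.44–48 + p.8 l.1–2 «E_K ≤ Π₀/(2νK²) … By dimensional analysis, Π₀ ≤ C·E(0)^{3/2}»,
typed as `K²E_K(t) ≤ C E(0)^{3/2}/(2ν)`: false on the same ray at `t = 0`, `K = n` (`K²E_K ≥ n²/4`, right side
fixed); `not_Theorem26_explicit` — p.8 l.3–21 «Ω_max ≤ C′E(0)^{15/8}/ν^{7/4}» (via the skeleton's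
`theorem26_of_explicit`); `not_Abstract_perShell` — abstract p.1 l.22–27 «Ω_K ≤ C₃²/(4ν²K²) at every shell»
(`Ω_K(a_K) ≥ K²/4`). HONEST SCOPE: the witness is the datum itself (`t = 0`); the lineage face `Theorem26_max`
(«≤ max(Ω(u₀), Ω_max(E(0), ν))») and any `Ω(0)`-dependent re-typing are a priori enstrophy bounds of open
strength (not attacked: no kernel object either way); Thm 2.1 («Proof (computational)», DNS `N = 8`) and
Lemma 2.4 («numerically verified») are typed AS ASSERTED and are not kernel-decided here.

Standard axioms only. WHAT THIS IS NOT: not a claim about NS regularity or blow-up; not a claim about any author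
beyond the typed locator. [cite: Higgins2026] [cite: RobinsonRodrigoSadowski2016, Thm. 4.4]
-/

set_option linter.dupNamespace false

open MeasureTheory Set
open scoped InnerProductSpace RealInnerProductSpace ComplexConjugate

namespace Summit.NavierStokesRegularity.NavierStokesRegularity.Theorems.Higgins2026

open Literature.Claims.NS.Higgins2026
open Literature.Analysis Literature.Analysis.FunctionSpaces

noncomputable section

/-! ## 1. The frequency ray `a_n = (sin 2πn x₃, cos 2πn x₃, 0)` -/

/-- Frequency `k₀ = n e₃ ∈ ℤ³`. [folklore] -/
def rayFreq (n : ℕ) : Z3 := fun j => if j = 2 then (n : ℤ) else 0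

/-- Polarisation `z = (−i, 1, 0) ∈ ℂ³` (circular, transversal to `e₃`). [folklore] -/
def rayVec : C3 := WithLp.toLp 2 ![-Complex.I, 1, 0]

/-- The ray datum `a_n(x) = Re (e_{k₀}(x) z) = (sin 2πn x₃, cos 2πn x₃, 0)`. [folklore] -/
def rayMode (n : ℕ) : T3 → E3 := Torus.realTrigPoly {rayFreq n} fun _ => rayVec

/-- `|k₀|² = n²`. [folklore] -/
theorem freqNormSq_rayFreq (n : ℕ) : Torus.freqNormSq (rayFreq n) = (n : ℝ) ^ 2 := by
  simp [Torus.freqNormSq, rayFreq]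

/-- `k₀ · z = 0`. [folklore] -/
theorem ray_transversal (n : ℕ) : ∑ j, ((rayFreq n j : ℤ) : ℂ) * rayVec j = 0 := by
  simp [rayFreq, rayVec]

/-- `‖z‖² = 2`. [folklore] -/
theorem norm_sq_rayVec : ‖rayVec‖ ^ 2 = 2 := by
  rw [EuclideanSpace.norm_sq_eq, Fin.sum_univ_three]
  simp [rayVec]
  norm_num

/-- `a_n` is a Galerkin mode of order `n` (smooth, divergence free, band-limited to `|k| ≤ n`). [folklore] -/
theorem isGalerkinMode_rayMode (n : ℕ) : FluidPDE.IsGalerkinMode n (rayMode n) := by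
  refine ⟨Torus.isSmooth_realTrigPoly _ _, Torus.isDivFree_realTrigPoly_singleton (ray_transversal n),
    fun k' hk' => Torus.mFourierCoeff_realTrigPoly_singleton_eq_zero _ _ ?_⟩
  rw [freqNormSq_rayFreq]; exact hk'

/-- `a_n` is a datum of Thm 3.1 (smooth, divergence free). [folklore] -/
theorem isDatum_rayMode (n : ℕ) : IsDatum (rayMode n) :=
  ⟨(isGalerkinMode_rayMode n).isSmooth, (isGalerkinMode_rayMode n).isDivFree⟩

/-- `P_N a_n = a_n` for `n ≤ N`. [folklore] -/
theorem fourierTruncate_rayMode {n N : ℕ} (h : n ≤ N) : Torus.fourierTruncate N (rayMode n) = rayMode n :=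
  Torus.fourierTruncate_eq_self ((isGalerkinMode_rayMode n).mono h).isSmooth.continuous
    fun _ hk => ((isGalerkinMode_rayMode n).mono h).mFourierCoeff_eq_zero hk

/-- `∫ ‖a_n‖² = 1` (`n ≠ 0`; Parseval on the single real mode). [folklore] -/
theorem integral_norm_sq_rayMode {n : ℕ} (hn : n ≠ 0) : ∫ x, ‖rayMode n x‖ ^ 2 = 1 := by
  have hint : Integrable (rayMode n) volume :=
    (Torus.continuous_realTrigPoly _ _).integrable_of_hasCompactSupport (HasCompactSupport.of_compactSpace _)
  have hne : rayFreq n ≠ -rayFreq n := by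
    intro h; have := congr_fun h 2; simp [rayFreq] at this; omega
  have h := Torus.integral_inner_realTrigPoly_singleton hint (rayFreq n) (fun _ => rayVec)
  rw [rayMode, Torus.mFourierCoeff_realTrigPoly_singleton, if_pos rfl, if_neg hne,
    EuclideanSpace.conjVec_zero, add_zero, inner_smul_left] at h
  have h1 : (⟪rayVec, rayVec⟫_ℂ).re = ‖rayVec‖ ^ 2 := by
    have := inner_self_eq_norm_sq (𝕜 := ℂ) rayVec
    simpa using this
  have hc : (starRingEnd ℂ) (2 : ℂ)⁻¹ = ((2⁻¹ : ℝ) : ℂ) := by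
    rw [map_inv₀, map_ofNat]; norm_num
  rw [hc, Complex.re_ofReal_mul, h1, norm_sq_rayVec] at h
  simp_rw [real_inner_self_eq_norm_sq] at h
  rw [rayMode, h]; norm_num

/-- **Energy is constant along the ray**: `E(a_n) = ½` for every `n ≥ 1`. [folklore] -/
theorem energy_rayMode {n : ℕ} (hn : n ≠ 0) : energy (rayMode n) = 2⁻¹ := by
  rw [energy, Torus.kineticEnergy, integral_norm_sq_rayMode hn, mul_one]

/-- `‖∇a_n‖² = 4π²n²` (`Δa_n = −4π²n² a_n` and `∫‖a_n‖² = 1`). [folklore] -/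
theorem gradNormSq_rayMode {n : ℕ} (hn : n ≠ 0) :
    Torus.gradNormSq (rayMode n) = 4 * Real.pi ^ 2 * (n : ℝ) ^ 2 := by
  have hs : Torus.IsSmooth (rayMode n) := Torus.isSmooth_realTrigPoly _ _
  have h := Torus.integral_inner_laplacian_self_eq_neg_gradNormSq_of_isSmooth hs
  have hlap : ∀ x, Torus.laplacian (rayMode n) x = -(4 * Real.pi ^ 2 * (n : ℝ) ^ 2) • rayMode n x :=
    fun x => by rw [rayMode, Torus.laplacian_realTrigPoly_singleton, freqNormSq_rayFreq]
  simp_rw [hlap, inner_smul_left, real_inner_self_eq_norm_sq] at h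
  rw [integral_const_mul, integral_norm_sq_rayMode hn] at h
  simp only [conj_trivial] at h
  linarith

/-- **Enstrophy is unbounded along the ray**: `Ω(a_n) = n²/2`. [folklore] -/
theorem enstrophy_rayMode {n : ℕ} (hn : n ≠ 0) : enstrophy (rayMode n) = (n : ℝ) ^ 2 / 2 := by
  rw [enstrophy, gradNormSq_rayMode hn]
  have hπ : Real.pi ≠ 0 := Real.pi_ne_zero
  field_simp
  ring

/-- A Galerkin trajectory of any order `N ≥ n` issued from `a_n` exists (tree: RRS 2016 Thm 4.4), and it is an
`IsGalerkinSol` from the datum `a_n` since `P_N a_n = a_n`. [cite: RobinsonRodrigoSadowski2016, Thm. 4.4] -/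
theorem exists_isGalerkinSol_rayMode {ν : ℝ} (hν : 0 ≤ ν) {n N : ℕ} (h : n ≤ N) :
    ∃ U : ℝ → T3 → E3, IsGalerkinSol ν N (rayMode n) U ∧ U 0 = rayMode n := by
  obtain ⟨U, hU, hU0⟩ := FluidPDE.Torus.exists_isGalerkinTrajectory_of_isGalerkinMode hν
    (MemLp.zero : MemLp (0 : T3 → E3) 2 volume) ((isGalerkinMode_rayMode n).mono h)
  exact ⟨U, ⟨hU, by rw [hU0, fourierTruncate_rayMode h]⟩, hU0⟩

/-! ## 2. The token: `Theorem26` (Thm 2.6 (4) p.7 l.18–25) is false -/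

/-- **`¬ Theorem26`** — no function `Ω_max(E(0), ν)` bounds the Galerkin enstrophy of all smooth divergence-free
data: along the ray `a_n` the energy is `½` while `Ω^(n)(0) = Ω(a_n) = n²/2 → ∞`. Binder `h26` of
`claim_of_steps`; first failing step of the printed chain established in kernel.
[cite: Higgins2026, Thm 2.6 (4) p.7 l.18–25] -/
theorem not_Theorem26 : ¬ Theorem26 := by
  rintro ⟨Ωmax, h⟩
  obtain ⟨n, hn⟩ := exists_nat_gt (max (2 * Ωmax 2⁻¹ 1) 1)
  have hn1 : (1 : ℝ) < n := lt_of_le_of_lt (le_max_right _ _) hn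
  have hnB : 2 * Ωmax 2⁻¹ 1 < n := lt_of_le_of_lt (le_max_left _ _) hn
  have hn0 : n ≠ 0 := by rintro rfl; norm_num at hn1
  obtain ⟨U, hU, hU0⟩ := exists_isGalerkinSol_rayMode (le_of_lt one_pos) (le_refl n)
  have key := h 1 one_pos (rayMode n) (isDatum_rayMode n) n U hU 0 le_rfl
  rw [hU0, enstrophy_rayMode hn0, energy_rayMode hn0] at key
  nlinarith

/-- **`¬ Theorem26_explicit`** — the explicit face p.8 l.3–21 «Ω_max ≤ C′E(0)^{15/8}/ν^{7/4}» implies the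
literal display (4) (skeleton `theorem26_of_explicit`), hence is false too. [cite: Higgins2026, Thm 2.6 proof p.8 l.1–21] -/
theorem not_Theorem26_explicit : ¬ Theorem26_explicit := fun h => not_Theorem26 (theorem26_of_explicit h)

/-! ## 3. Inside the printed proof of Thm 2.6: the per-shell Kolmogorov bound (p.7 l.44 – p.8 l.2) is false -/

/-- The `k₀`-coefficient of `a_n`: `â(k₀) = z/2` (`n ≠ 0`). [folklore] -/
theorem coeff_rayMode {n : ℕ} (hn : n ≠ 0) : coeff (rayMode n) (rayFreq n) = (2 : ℂ)⁻¹ • rayVec := by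
  have hne : rayFreq n ≠ -rayFreq n := by
    intro h; have := congr_fun h 2; simp [rayFreq] at this; omega
  rw [coeff, rayMode, Torus.mFourierCoeff_realTrigPoly_singleton, if_pos rfl, if_neg hne,
    EuclideanSpace.conjVec_zero, add_zero]

/-- `‖â(k₀)‖² = ½`. [folklore] -/
theorem norm_sq_coeff_rayMode {n : ℕ} (hn : n ≠ 0) : ‖coeff (rayMode n) (rayFreq n)‖ ^ 2 = 2⁻¹ := by
  rw [coeff_rayMode hn, norm_smul, mul_pow, norm_sq_rayVec, norm_inv, Complex.norm_ofNat]
  norm_num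

/-- `k₀ = n e₃` lies in shell `n` (`|k₀| = n`). [folklore] -/
theorem rayFreq_mem_shell (n : ℕ) : rayFreq n ∈ shell n := by
  rw [shell, Finset.mem_filter, Fintype.mem_piFinset, latt, freqNormSq_rayFreq,
    Real.sqrt_sq (Nat.cast_nonneg n)]
  refine ⟨fun j => ?_, by linarith, by linarith⟩
  simp only [rayFreq, Finset.mem_Icc]
  split_ifs <;> omega

/-- Shell energy of the ray datum at its own shell: `E_n(a_n) ≥ ¼`. [folklore] -/
theorem shellEnergy_rayMode_ge {n : ℕ} (hn : n ≠ 0) : 4⁻¹ ≤ shellEnergy n (rayMode n) := by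
  have h := Finset.single_le_sum (f := fun k => ‖coeff (rayMode n) k‖ ^ 2) (fun _ _ => sq_nonneg _)
    (rayFreq_mem_shell n)
  simp only [norm_sq_coeff_rayMode hn] at h
  rw [shellEnergy]
  linarith

/-- Shell enstrophy of the ray datum at its own shell: `Ω_n(a_n) ≥ n²/4`. [folklore] -/
theorem shellEnstrophy_rayMode_ge {n : ℕ} (hn : n ≠ 0) : (n : ℝ) ^ 2 / 4 ≤ shellEnstrophy n (rayMode n) := by
  have h := Finset.single_le_sum (f := fun k => Torus.freqNormSq k * ‖coeff (rayMode n) k‖ ^ 2)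
    (fun _ _ => mul_nonneg (Torus.freqNormSq_nonneg _) (sq_nonneg _)) (rayFreq_mem_shell n)
  simp only [norm_sq_coeff_rayMode hn, freqNormSq_rayFreq] at h
  rw [shellEnstrophy]
  linarith

/-- **`¬ Kol_perShell`** — «E_K ≤ Π₀/(2νK²)» with «Π₀ ≤ C·E(0)^{3/2} by dimensional analysis» (p.7 l.44–48,
p.8 l.1–2), i.e. `K²E_K(t) ≤ C E(0)^{3/2}/(2ν)` for every trajectory, shell and `t ≥ 0`: false at `t = 0` on the
ray (`K = n`: `K²E_K ≥ n²/4`, while `E(0) = ½` is fixed). [cite: Higgins2026, Thm 2.6 proof p.7 l.44–48, p.8 l.1–2] -/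
theorem not_Kol_perShell : ¬ Kol_perShell := by
  rintro ⟨C, hC, h⟩
  obtain ⟨n, hn⟩ := exists_nat_gt (max (4 * C) 1)
  have hn1 : (1 : ℝ) < n := lt_of_le_of_lt (le_max_right _ _) hn
  have hnC : 4 * C < n := lt_of_le_of_lt (le_max_left _ _) hn
  have hn0 : n ≠ 0 := by rintro rfl; norm_num at hn1
  obtain ⟨U, hU, hU0⟩ := exists_isGalerkinSol_rayMode (le_of_lt one_pos) (le_refl n)
  have key := h 1 one_pos (rayMode n) (isDatum_rayMode n) n U hU 0 le_rfl n (Nat.one_le_iff_ne_zero.2 hn0)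
  rw [hU0, energy_rayMode hn0] at key
  have hr : ((2⁻¹ : ℝ)) ^ (3 / 2 : ℝ) ≤ 1 := Real.rpow_le_one (by norm_num) (by norm_num) (by norm_num)
  have hE := shellEnergy_rayMode_ge hn0
  have h1 : C * (2⁻¹ : ℝ) ^ (3 / 2 : ℝ) / (2 * 1) ≤ C := by
    rw [mul_one, div_le_iff₀ (by norm_num : (0 : ℝ) < 2)]
    nlinarith
  nlinarith

/-! ## 4. Records: the abstract per-shell bound (p.1 l.22–27) is false on the same ray -/

/-- **`¬ Abstract_perShell`** — «a per-shell bound Ω_K ≤ C₃²/(4ν²K²) at every shell» (abstract p.1 l.22–27,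
l.42–46, for all `t`): at `t = 0` the ray datum `a_K` in the saturated truncation `N = 2K + 1` has
`Ω_K(a_K) ≥ K²/4`, unbounded in `K`, while `C₃²/(4K²) ≤ C₃²/4`. Alongside only (the abstract is not a
binder). [cite: Higgins2026, Abstract p.1 l.19–27, l.39–46] -/
theorem not_Abstract_perShell : ¬ Abstract_perShell := by
  rintro ⟨C₃, hC₃, h⟩
  obtain ⟨K, hK⟩ := exists_nat_gt (max (C₃ ^ 2) 1)
  have hK1 : (1 : ℝ) < K := lt_of_le_of_lt (le_max_right _ _) hK
  have hKC : C₃ ^ 2 < K := lt_of_le_of_lt (le_max_left _ _) hK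
  have hK0 : K ≠ 0 := by rintro rfl; norm_num at hK1
  obtain ⟨U, hU, hU0⟩ := exists_isGalerkinSol_rayMode (le_of_lt one_pos) (by omega : K ≤ 2 * K + 1)
  have key := h 1 one_pos (rayMode K) (isDatum_rayMode K) (2 * K + 1) U hU K
    (Nat.one_le_iff_ne_zero.2 hK0) le_rfl 0 le_rfl
  rw [hU0] at key
  have hE := shellEnstrophy_rayMode_ge hK0
  have hKpos : (0 : ℝ) < (K : ℝ) ^ 2 := by positivity
  have h2 : C₃ ^ 2 / (4 * 1 ^ 2 * (K : ℝ) ^ 2) ≤ C₃ ^ 2 / 4 := by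
    apply div_le_div_of_nonneg_left (sq_nonneg _) (by norm_num)
    nlinarith
  nlinarith

-- Standard axioms only: [propext, Classical.choice, Quot.sound].
#print axioms not_Theorem26
#print axioms not_Theorem26_explicit
#print axioms not_Kol_perShell
#print axioms not_Abstract_perShell

end

end Summit.NavierStokesRegularity.NavierStokesRegularity.Theorems.Higgins2026
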